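import Summits.ABC.IUTFork.Joshi.ThetaLociPadicModel
import Summits.ABC.IUTFork.Joshi.LogVolumesHullsAdelic
import Summits.ABC.IUTFork.Joshi.LogVolumesHullsScalingRigidity
import HarnessLib

/-!
# Joshi, *Arithmetic Teichmüller Spaces III* (arXiv:2401.13508v4) §9.9–§9.11: the VOLUME-side input signature
# `LogVol.ScalingDatum ℓ*` INHABITED over the one field `ℚ_p` at EVERY `ℓ* ≥ 1` (label-dependent Tate roots)

Non-vacuity companion (abc-iut cell, branch E, rung LADDER-ABC:A2.E; seat abc-iut-E-t22, slot T-22, generation 3) — the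
volume-side twin of the T-22 size-side model `ATS3.padicLociModel` (p436602). It answers, in kernel, the second reader's note on
p436602 (abc-iut-E-t56, STATUS 2026-08-26T10:02:23Z, I2): «size form: NV at every ℓ* (p436602); volume form: NV at ℓ* = 1 only
(p430954/p432258)». Render `HOME/lit/renders/Joshi-arxiv-2401.13508/pNNNN.txt` («p.N l.M»).

THE MODEL (every prime `p`, every `ℓ* ≥ 1`; all carriers are abc-iut-E-t23's signatures BY NAME — `LogVol.VolumeDatum` /
`TensorVolumeDatum` (p428811), `ExhibitedDatum` (p429037), `ScalingDatum` (p429684), `adelicLocusDatum` (p432258)):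
* every tensor factor `L′_{w,j} := ℚ_p` (`j = 1, …, ℓ*`) with E-t23's PROVED §9.10.2 datum `padicVolumeDatum p` (p430954: `Vol` =
  Mochizuki's `μ_{ℚ_p}`, `𝒪 = ℤ_p`, `|−| = ‖−‖_p`) — ONE field with ONE Vol-compatible absolute value at every label;
* weights `γ_j = 1` (= `gammaP` at degree `[ℚ_p : ℚ_p] = 1`); ambient space `X := ℚ_p` (`ℚ_p ⊗_{ℚ_p} ⋯ ⊗_{ℚ_p} ℚ_p = ℚ_p` by
  multiplication), `Vol := μ_{ℚ_p}`; the ball-tensor `V_1 ⊗ ⋯ ⊗ V_{ℓ*}` ↦ the `0`-centred ball of radius `∏_j Vol(V_j)` — on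
  CENTRED ball-tensors `(λ_1ℤ_p) ⊗ ⋯ ⊗ (λ_{ℓ*}ℤ_p)` this IS the image of the multiplication map (`padicLabelsTens_eq_image_mul`,
  proved); centres are forgotten (print's (9.10.3.1), p.124 l.8–11, defines `Vol^Γ` on ball-tensors by the product formula and
  Lem. 9.10.7.1, p.125 l.42–55, only meets centred ones); hull operator = identity (the sets met are balls);
* LABEL-DEPENDENT Tate-root stand-ins `q^{1/2ℓ}_{w;j} := q_j = p^{j²}` and exhibited classes READ as (9.7.2.2)/(9.9.2) prescribe,
  `τ_j := p*⁻¹·log_p(1 + p*·q_j)` — p436602's `padicModelQ` / `padicModelXi`; `|q_w^{1/2ℓ}| := p^{−ℓ*²}`;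
* the `w`-locus `Θ̃^𝓘_{Mochizuki,w} :=` the ball-tensor `⊗_j τ_jℤ_p` itself (`= (∏_j τ_j)·ℤ_p`), its norm set `{‖x‖ : x ∈ locus}`,
  sup-norm `∏_j ‖τ_j‖` (attained at `∏_j τ_j`), tensor norm `‖∏_j τ_j‖`.

PROVED AT THE MODEL (nothing posited): the three object-level inputs of p429684 — `NormLogBK` ((9.9.2)–(9.9.3), by Lemma 9.8.2.7
= p434712 `norm_pStar_inv_mul_unitLog_one_add_mul`, NOT by `rfl`), `RootScaling scalingExponent` ((9.9.4) with print's law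
`j²/ℓ*²`, p.121 l.39–66), `CrossNorm` (`‖∏ τ_j‖ = ∏ ‖τ_j‖`, the cross-norm property of multiplication) — and the sign convention
`LogVolNonpos`; HENCE, through E-t23's / E-t4's landed implications only: `ValuationScaling`, `StandardPointInLocus`,
`HullVolumeLowerBound` (Lem. 9.10.7.1), Thm. 9.9.1's and Thm. 9.11.1's `w`-components, Cor. 9.11.1.1 at `w`, and Thm. 9.11.1 /
Cor. 9.11.1.1 for the one-place adelic assembly. So the typed §9.9–§9.11 VOLUME chain is inhabited at EVERY `ℓ* ≥ 1` over a
genuine `p`-adic field (tree before this file: `ℓ* = 1` only, p430954 `padicExhibitedDatum` / p432258 `padicScalingDatum`).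
RIGIDITY CHECK (abc-iut-E-t56 p433446 `lstar_le_one_of_rootScaling_of_abs_const`: label-INDEPENDENT root norms + (9.9.4) ⇒
`ℓ* ≤ 1`): at this model the root norms `‖q_j‖ = p^{−j²}` DO depend on the label, so for `ℓ* ≥ 2` the rigidity hypothesis FAILS
(`padicLabelsScaling_abs_qrt_not_const`) — the model sits on the «elements horn» of that located line (abc-iut-E-t23 nuance,
STATUS 08:54:01Z): one field, one Vol-compatible absolute value, label-dependent ELEMENTS. What the model does NOT carry: several
places, distinct fields `L′_{w,j}`, genuine (non-multiplicative) tensor products, Mochizuki's hull beyond balls, the arithmetic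
origin of the `j²` law (put in by hand per label, as in p436602) — labelled, not hidden. A model exhibits satisfiability, nothing
more. Classical `p`-adic analysis; nothing of [IUTchIII] Cor. 3.12 is asserted; no side taken on any author (Mochizuki /
Scholze–Stix / Joshi / Dupuy–Hilado); typed ≠ proved ≠ endorsed. The σ-algebra on `ℚ_p` is a binder (`[MeasurableSpace ℚ_[p]]
[BorelSpace ℚ_[p]]`), as in E-t23's files; no instance is declared. [claim: Joshi2024ATS3, status: disputed] marks docstrings
whose DISPLAY is Joshi's.
-/

noncomputable section

open Set Metric MeasureTheory

namespace Summit.ABC.IUTFork.Joshi.LogVol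

open Literature.IUT.LogVolume ATS3

variable (p : ℕ) [hp : Fact p.Prime]

/-! ## 0. The exhibited classes `τ_j = p*⁻¹·log_p(1 + p*·p^{j²})` (p436602) are non-zero of norm `p^{−j²}` -/

/-- `τ_j = p*⁻¹·log_p(1 + p*·p^{j²})` has norm `p^{−j²}` (Lemma 9.8.2.7, p434712, through p436602's `norm_padicModelXi`).
[folklore] -/
theorem norm_padicModelXi_succ (j : ℕ) : ‖padicModelXi p (j + 1)‖ = ((p : ℝ)⁻¹) ^ ((j + 1) ^ 2) := by
  rw [norm_padicModelXi, norm_padicModelQ]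

/-- … in particular `τ_j ≠ 0`. [folklore] -/
theorem padicModelXi_succ_ne_zero (j : ℕ) : padicModelXi p (j + 1) ≠ 0 := by
  rw [← norm_pos_iff, norm_padicModelXi_succ]
  exact pow_pos (inv_pos.2 (by exact_mod_cast hp.out.pos)) _

variable [MeasurableSpace ℚ_[p]] [BorelSpace ℚ_[p]] (lstar : ℕ)

/-! ## 1. The ball-tensor map on `X = ℚ_p` -/

/-- The ball-tensor of the model: `(V_j)_j ↦` the `0`-centred ball of radius `∏_j Vol_{ℚ_p}(V_j)` in `X = ℚ_p` (on centred
ball-tensors = the multiplication image, `padicLabelsTens_eq_image_mul`). [folklore] -/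
def padicLabelsTens (V : Fin lstar → Set ℚ_[p]) : Set ℚ_[p] :=
  closedBall 0 (∏ i, ((padicVolumeDatum p).vol (V i)).toReal)

/-- On a ball-tensor `(α_j + λ_jℤ_p)_j`, `λ_j ≠ 0`, the model's tensor set is the ball of radius `∏_j ‖λ_j‖_p`. [folklore] -/
theorem padicLabelsTens_ball (α l : Fin lstar → ℚ_[p]) (hl : ∀ i, l i ≠ 0) :
    padicLabelsTens p lstar (fun i => (padicVolumeDatum p).ball (α i) (l i)) = closedBall 0 (∏ i, ‖l i‖) := by
  unfold padicLabelsTens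
  congr 1
  exact Finset.prod_congr rfl fun i _ => by
    rw [padicVolumeDatum_vol_ball p (α i) (hl i), ENNReal.toReal_ofReal (norm_nonneg _)]

/-- Membership in E-t23's ball `λ·ℤ_p` (as `VolumeDatum.ball 0 λ` of `padicVolumeDatum`) is `‖x‖ ≤ ‖λ‖` (`λ ≠ 0`). [folklore] -/
theorem mem_padicVolumeDatum_ball_zero_iff {l : ℚ_[p]} (hl : l ≠ 0) (x : ℚ_[p]) :
    x ∈ (padicVolumeDatum p).ball 0 l ↔ ‖x‖ ≤ ‖l‖ := by
  simp only [VolumeDatum.ball, zero_add, mem_image, SetLike.mem_coe]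
  constructor
  · rintro ⟨z, hz, rfl⟩
    rw [norm_mul]
    exact mul_le_of_le_one_right (norm_nonneg l) ((PadicInt.mem_subring_iff p).1 hz)
  · intro hx
    refine ⟨l⁻¹ * x, (PadicInt.mem_subring_iff p).2 ?_, by rw [← mul_assoc, mul_inv_cancel₀ hl, one_mul]⟩
    rw [norm_mul, norm_inv, inv_mul_le_iff₀ (norm_pos_iff.2 hl), mul_one]
    exact hx

/-- **HONESTY LEMMA**: on CENTRED ball-tensors `(λ_1ℤ_p) ⊗ ⋯ ⊗ (λ_{ℓ*}ℤ_p)` (`ℓ* ≥ 1`, `λ_j ≠ 0`) the model's tensor set IS the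
image of the multiplication map `ℚ_p × ⋯ × ℚ_p → ℚ_p = ℚ_p ⊗_{ℚ_p} ⋯ ⊗_{ℚ_p} ℚ_p`: `{∏_j x_j : x_j ∈ λ_jℤ_p} = (∏_j λ_j)·ℤ_p`.
[folklore] -/
theorem padicLabelsTens_eq_image_mul (hls : 0 < lstar) (l : Fin lstar → ℚ_[p]) (hl : ∀ i, l i ≠ 0) :
    padicLabelsTens p lstar (fun i => (padicVolumeDatum p).ball 0 (l i)) =
      (fun x : Fin lstar → ℚ_[p] => ∏ i, x i) '' Set.univ.pi fun i => (padicVolumeDatum p).ball 0 (l i) := by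
  have hball := padicLabelsTens_ball p lstar 0 l hl
  simp only [Pi.zero_apply] at hball
  rw [hball]
  have hL : (∏ i, l i) ≠ 0 := Finset.prod_ne_zero_iff.2 fun i _ => hl i
  ext y
  simp only [mem_closedBall, dist_zero_right, mem_image, mem_univ_pi]
  constructor
  · intro hy
    set i₀ : Fin lstar := ⟨0, hls⟩
    refine ⟨Function.update l i₀ (l i₀ * ((∏ i, l i)⁻¹ * y)), fun i => ?_, ?_⟩
    · by_cases hi : i = i₀
      · subst hi
        rw [Function.update_self, mem_padicVolumeDatum_ball_zero_iff p (hl _), norm_mul]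
        refine mul_le_of_le_one_right (norm_nonneg _) ?_
        rw [norm_mul, norm_inv, inv_mul_le_iff₀ (norm_pos_iff.2 hL), mul_one, norm_prod]
        exact hy
      · rw [Function.update_of_ne hi, mem_padicVolumeDatum_ball_zero_iff p (hl i)]
    · rw [Finset.prod_update_of_mem (Finset.mem_univ i₀), Finset.sdiff_singleton_eq_erase, mul_assoc,
        mul_comm ((∏ i, l i)⁻¹ * y), ← mul_assoc, Finset.mul_prod_erase _ _ (Finset.mem_univ i₀),
        mul_inv_cancel_left₀ hL]
  · rintro ⟨x, hx, rfl⟩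
    rw [norm_prod]
    exact Finset.prod_le_prod (fun i _ => norm_nonneg _) fun i _ =>
      (mem_padicVolumeDatum_ball_zero_iff p (hl i) (x i)).1 (hx i)

/-! ## 2. The §9.10 tensor-volume datum over `ℚ_p` with `ℓ*` labels -/

/-- **The §9.10 tensor-volume datum of the model** (E-t23's `TensorVolumeDatum`, p428811): factors `ℚ_p` with `padicVolumeDatum`,
weights `1`, `X = ℚ_p`, `Vol = μ_{ℚ_p}`, ball-tensor = `padicLabelsTens`, hull = identity; (9.10.3.1) `vol_tens` is a THEOREM
(`μ((∏λ_j)ℤ_p) = ∏‖λ_j‖`, Weil *BNT* I §2 via the Literature layer). [folklore] -/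
def padicLabelsTensorDatum : TensorVolumeDatum (Fin lstar) (fun _ => ℚ_[p]) ℚ_[p] where
  D := fun _ => padicVolumeDatum p
  Γ := ⟨fun _ => 1, fun _ => one_pos, fun _ => le_rfl⟩
  vol := localVolume ℚ_[p]
  tens := padicLabelsTens p lstar
  vol_tens := fun α l hl => by
    have hL : (∏ i, l i) ≠ 0 := Finset.prod_ne_zero_iff.2 fun i _ => hl i
    rw [padicLabelsTens_ball p lstar α l hl, weightedVol_ball _ _ α l hl, ← norm_prod, ← image_mul_unitBall p hL,
      localVolume_image_mul_unitBall p hL, norm_prod]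
    congr 1
    exact Finset.prod_congr rfl fun i _ => by rw [padicVolumeDatum_abs, Real.rpow_one]
  hull := id
  subset_hull := fun _ => le_rfl
  hull_mono := fun _ _ h => h

/-! ## 3. The exhibited-element datum and the scaling datum (every `ℓ* ≥ 1`) -/

variable {lstar}

/-- **The exhibited-element datum of the model** (E-t23's `ExhibitedDatum`, p429037) at `ℓ* ≥ 1`: `τ_j := p*⁻¹·log_p(1 + p*·p^{j²})`
(`j = i+1`), `|q_w^{1/2ℓ}| := p^{−ℓ*²}`, locus `:=` the ball-tensor `⊗_j τ_jℤ_p`, sup-norm `∏_j ‖τ_j‖`.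
[claim: Joshi2024ATS3, status: disputed] -/
def padicLabelsExhibited (hl : 0 < lstar) : ExhibitedDatum lstar (fun _ => ℚ_[p]) ℚ_[p] where
  toTensorVolumeDatum := padicLabelsTensorDatum p lstar
  qroot := (p : ℝ) ^ (-((lstar : ℝ) ^ 2))
  qroot_pos := padicModel_qroot_pos p lstar
  qroot_lt_one := padicModel_qroot_lt_one p lstar hl
  τ := fun i => padicModelXi p ((i : ℕ) + 1)
  τ_mem := fun i => (PadicInt.mem_subring_iff p).2 (mem_closedBall_zero_iff.1 (padicModelXi_mem p _))
  τ_ne := fun i => padicModelXi_succ_ne_zero p i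
  locus := padicLabelsTens p lstar fun i => (padicVolumeDatum p).ball 0 (padicModelXi p ((i : ℕ) + 1))
  tens_subset_locus := le_rfl
  vol_hull_ne_top := by
    change localVolume ℚ_[p] (padicLabelsTens p lstar _) ≠ ⊤
    rw [show localVolume ℚ_[p] (padicLabelsTens p lstar fun i =>
        (padicVolumeDatum p).ball 0 (padicModelXi p ((i : ℕ) + 1))) = _ from
      (padicLabelsTensorDatum p lstar).vol_tens 0 _ fun i => padicModelXi_succ_ne_zero p i]
    exact ENNReal.ofReal_ne_top
  supNorm := ∏ i : Fin lstar, ‖padicModelXi p ((i : ℕ) + 1)‖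

/-- The model's locus is the ball `(∏_j τ_j)·ℤ_p` of radius `∏_j ‖τ_j‖`. [folklore] -/
theorem padicLabelsExhibited_locus (hl : 0 < lstar) :
    (padicLabelsExhibited p hl).locus = closedBall 0 (∏ i : Fin lstar, ‖padicModelXi p ((i : ℕ) + 1)‖) :=
  padicLabelsTens_ball p lstar 0 _ fun i => padicModelXi_succ_ne_zero p i

/-- The product `∏_j τ_j` lies in the locus (it is the image of `⊗_j τ_j`). [folklore] -/
theorem prod_padicModelXi_mem_locus (hl : 0 < lstar) :
    (∏ i : Fin lstar, padicModelXi p ((i : ℕ) + 1)) ∈ (padicLabelsExhibited p hl).locus := by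
  rw [padicLabelsExhibited_locus, mem_closedBall, dist_zero_right, norm_prod]

/-- **The scaling datum of the model** (E-t23's `ScalingDatum`, p429684) at `ℓ* ≥ 1`: LABEL-DEPENDENT roots `q^{1/2ℓ}_{w;j} := p^{j²}`,
locus norms `{‖x‖ : x ∈ locus}`, tensor norm `‖∏_j τ_j‖`. [claim: Joshi2024ATS3, status: disputed] -/
def padicLabelsScaling (hl : 0 < lstar) : ScalingDatum lstar (fun _ => ℚ_[p]) ℚ_[p] where
  toExhibitedDatum := padicLabelsExhibited p hl
  qrt := fun i => padicModelQ p ((i : ℕ) + 1)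
  locusNorms := (fun x => ‖x‖) '' (padicLabelsExhibited p hl).locus
  locusNorms_bdd := by
    refine ⟨∏ i : Fin lstar, ‖padicModelXi p ((i : ℕ) + 1)‖, ?_⟩
    rintro _ ⟨x, hx, rfl⟩
    rw [padicLabelsExhibited_locus, mem_closedBall, dist_zero_right] at hx
    exact hx
  supNorm_eq := by
    change (∏ i : Fin lstar, ‖padicModelXi p ((i : ℕ) + 1)‖) = _
    refine (IsGreatest.csSup_eq (s := (fun x => ‖x‖) '' (padicLabelsExhibited p hl).locus)
      (a := ∏ i : Fin lstar, ‖padicModelXi p ((i : ℕ) + 1)‖) ⟨?_, ?_⟩).symm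
    · exact ⟨_, prod_padicModelXi_mem_locus p hl, norm_prod _ _⟩
    · rintro _ ⟨x, hx, rfl⟩
      rw [padicLabelsExhibited_locus, mem_closedBall, dist_zero_right] at hx
      exact hx
  tensorNorm := ‖∏ i : Fin lstar, padicModelXi p ((i : ℕ) + 1)‖
  tensorNorm_mem := ⟨_, prod_padicModelXi_mem_locus p hl, rfl⟩

/-! ## 4. The three object-level inputs and the sign convention HOLD at the model -/

/-- **(9.9.2)–(9.9.3) `NormLogBK` at the model**: `‖p*⁻¹·log_p(1 + p*·q_j)‖ = ‖q_j‖` — Lemma 9.8.2.7 (p434712), not `rfl`.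
[claim: Joshi2024ATS3, status: disputed] -/
theorem padicLabelsScaling_normLogBK (hl : 0 < lstar) : (padicLabelsScaling p hl).NormLogBK := fun i =>
  norm_padicModelXi p ((i : ℕ) + 1)

/-- **(9.9.4) `RootScaling scalingExponent` at the model**: `‖p^{j²}‖ = (p^{−ℓ*²})^{j²/ℓ*²}` (p436602's root law).
[claim: Joshi2024ATS3, status: disputed] -/
theorem padicLabelsScaling_rootScaling (hl : 0 < lstar) :
    (padicLabelsScaling p hl).RootScaling (LocusDatum.scalingExponent lstar) := fun i =>
  norm_padicModelQ_succ_eq_rpow p hl i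

/-- **`CrossNorm` at the model**: `‖∏_j τ_j‖ = ∏_j ‖τ_j‖` (multiplicativity of `‖−‖_p` = the cross-norm property of the
multiplication map). [claim: Joshi2024ATS3, status: disputed] -/
theorem padicLabelsScaling_crossNorm (hl : 0 < lstar) : (padicLabelsScaling p hl).CrossNorm := norm_prod _ _

/-- **ALL THREE object-level inputs of p429684 hold at the model, at every `ℓ* ≥ 1`.** [folklore] -/
theorem padicLabelsScaling_inputs (hl : 0 < lstar) :
    (padicLabelsScaling p hl).NormLogBK ∧ (padicLabelsScaling p hl).RootScaling (LocusDatum.scalingExponent lstar) ∧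
      (padicLabelsScaling p hl).CrossNorm :=
  ⟨padicLabelsScaling_normLogBK p hl, padicLabelsScaling_rootScaling p hl, padicLabelsScaling_crossNorm p hl⟩

/-- The hull volume of the model, read on E-t4's carrier, is `μ((∏τ_j)ℤ_p) = ∏_j p^{−j²}` — a Haar-measure COMPUTATION.
[folklore] -/
theorem padicLabelsScaling_hullVol (hl : 0 < lstar) :
    (padicLabelsScaling p hl).toLocusDatum.hullVol = ∏ i : Fin lstar, ((p : ℝ)⁻¹) ^ (((i : ℕ) + 1) ^ 2) := by
  have hne : ∀ i : Fin lstar, padicModelXi p ((i : ℕ) + 1) ≠ 0 := fun i => padicModelXi_succ_ne_zero p i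
  change (localVolume ℚ_[p] (id (padicLabelsTens p lstar fun i =>
    (padicVolumeDatum p).ball 0 (padicModelXi p ((i : ℕ) + 1))))).toReal = _
  rw [id, show localVolume ℚ_[p] (padicLabelsTens p lstar fun i =>
      (padicVolumeDatum p).ball 0 (padicModelXi p ((i : ℕ) + 1))) = _ from
    (padicLabelsTensorDatum p lstar).vol_tens 0 _ hne,
    weightedVol_ball _ _ 0 (fun i : Fin lstar => padicModelXi p ((i : ℕ) + 1)) hne]
  refine (ENNReal.toReal_ofReal (Finset.prod_nonneg fun i _ => Real.rpow_nonneg (AbsoluteValue.nonneg _ _) _)).trans ?_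
  exact Finset.prod_congr rfl fun i _ => by
    change ‖padicModelXi p ((i : ℕ) + 1)‖ ^ ((1 : ℝ)) = _
    rw [Real.rpow_one, norm_padicModelXi_succ]

/-- **The sign convention `LogVolNonpos` (`Vol ≤ 1`) at the model**: `∏_j p^{−j²} ≤ 1`. [folklore] -/
theorem padicLabelsScaling_logVolNonpos (hl : 0 < lstar) : (padicLabelsScaling p hl).toLocusDatum.LogVolNonpos := by
  change (padicLabelsScaling p hl).toLocusDatum.hullVol ≤ 1
  rw [padicLabelsScaling_hullVol]
  have hp1 : (1 : ℝ) ≤ p := by exact_mod_cast hp.out.one_lt.le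
  exact Finset.prod_le_one (fun i _ => by positivity) fun i _ =>
    pow_le_one₀ (inv_nonneg.2 (by positivity)) (inv_le_one_of_one_le₀ hp1)

/-! ## 5. Hence the whole typed §9.9–§9.11 volume chain holds at the model (landed implications only) -/

/-- (9.9.4) `ValuationScaling` for the model's projection onto E-t4's carrier. [claim: Joshi2024ATS3, status: disputed] -/
theorem padicLabelsScaling_valuationScaling (hl : 0 < lstar) : (padicLabelsScaling p hl).toLocusDatum.ValuationScaling :=
  (padicLabelsScaling p hl).valuationScaling_of (padicLabelsScaling_normLogBK p hl) (padicLabelsScaling_rootScaling p hl)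

/-- `StandardPointInLocus` for the projection (from `CrossNorm`). [claim: Joshi2024ATS3, status: disputed] -/
theorem padicLabelsScaling_standardPointInLocus (hl : 0 < lstar) :
    (padicLabelsScaling p hl).toLocusDatum.StandardPointInLocus :=
  (padicLabelsScaling p hl).standardPointInLocus_of (padicLabelsScaling_crossNorm p hl)

/-- `HullVolumeLowerBound` for the projection — Lem. 9.10.7.1 (E-t23 p429037), unconditionally. [claim: Joshi2024ATS3, status: disputed] -/
theorem padicLabelsScaling_hullVolumeLowerBound (hl : 0 < lstar) :
    (padicLabelsScaling p hl).toLocusDatum.HullVolumeLowerBound :=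
  (padicLabelsScaling p hl).toExhibitedDatum.hullVolumeLowerBound_toLocusDatum

/-- **Thm. 9.9.1, `w`-component (sup form), at the model.** [claim: Joshi2024ATS3, status: disputed] -/
theorem padicLabelsScaling_fundamentalEstimateSup (hl : 0 < lstar) :
    (padicLabelsScaling p hl).toLocusDatum.FundamentalEstimateSup :=
  (padicLabelsScaling p hl).fundamentalEstimateSup_of_inputs (padicLabelsScaling_normLogBK p hl)
    (padicLabelsScaling_rootScaling p hl) (padicLabelsScaling_crossNorm p hl)

/-- **Thm. 9.11.1, `w`-component (VOLUME form), at the model — at every `ℓ* ≥ 1`.** [claim: Joshi2024ATS3, status: disputed] -/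
theorem padicLabelsScaling_fundamentalEstimateVol (hl : 0 < lstar) :
    (padicLabelsScaling p hl).toLocusDatum.FundamentalEstimateVol :=
  (padicLabelsScaling p hl).fundamentalEstimateVol_of_inputs (padicLabelsScaling_normLogBK p hl)
    (padicLabelsScaling_rootScaling p hl)

/-- **Cor. 9.11.1.1 at `w` (Joshi's «[IUTchIII] Cor. 3.12», volume level), at the model.** [claim: Joshi2024ATS3, status: disputed] -/
theorem padicLabelsScaling_cor91111 (hl : 0 < lstar) : (padicLabelsScaling p hl).toLocusDatum.Cor91111 :=
  (padicLabelsScaling p hl).cor91111_of_inputs (padicLabelsScaling_normLogBK p hl) (padicLabelsScaling_rootScaling p hl)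
    (padicLabelsScaling_logVolNonpos p hl)

/-- **PROFILE (conjunction)**: at the `ℚ_p` model with `ℓ* ≥ 1` labels, every input and every conclusion of the typed §9.9–§9.11
volume chain holds. Non-vacuity of the VOLUME form at every `ℓ*`. [folklore] -/
theorem padicLabelsScaling_profile (hl : 0 < lstar) :
    (padicLabelsScaling p hl).NormLogBK ∧ (padicLabelsScaling p hl).RootScaling (LocusDatum.scalingExponent lstar) ∧
    (padicLabelsScaling p hl).CrossNorm ∧ (padicLabelsScaling p hl).toLocusDatum.LogVolNonpos ∧
    (padicLabelsScaling p hl).toLocusDatum.ValuationScaling ∧ (padicLabelsScaling p hl).toLocusDatum.StandardPointInLocus ∧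
    (padicLabelsScaling p hl).toLocusDatum.HullVolumeLowerBound ∧ (padicLabelsScaling p hl).toLocusDatum.FundamentalEstimateSup ∧
    (padicLabelsScaling p hl).toLocusDatum.FundamentalEstimateVol ∧ (padicLabelsScaling p hl).toLocusDatum.Cor91111 :=
  ⟨padicLabelsScaling_normLogBK p hl, padicLabelsScaling_rootScaling p hl, padicLabelsScaling_crossNorm p hl,
    padicLabelsScaling_logVolNonpos p hl, padicLabelsScaling_valuationScaling p hl,
    padicLabelsScaling_standardPointInLocus p hl, padicLabelsScaling_hullVolumeLowerBound p hl,
    padicLabelsScaling_fundamentalEstimateSup p hl, padicLabelsScaling_fundamentalEstimateVol p hl,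
    padicLabelsScaling_cor91111 p hl⟩

/-! ## 6. The rigidity hypothesis of p433446 FAILS at the model for `ℓ* ≥ 2` (label-dependent roots in ONE field) -/

/-- The §9.10.2 absolute value of the `j`-th root at the model: `|q^{1/2ℓ}_{w;j}| = ‖p^{j²}‖_p = p^{−j²}`. [folklore] -/
theorem padicLabelsScaling_abs_qrt (hl : 0 < lstar) (i : Fin lstar) :
    ((padicLabelsScaling p hl).D i).abs ((padicLabelsScaling p hl).qrt i) = ((p : ℝ)⁻¹) ^ (((i : ℕ) + 1) ^ 2) :=
  norm_padicModelQ p _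

/-- **The hypothesis of E-t56's rigidity lemma `lstar_le_one_of_rootScaling_of_abs_const` (p433446) is FALSE here for `ℓ* ≥ 2`**:
the root norms `p^{−1}` (label `1`) and `p^{−4}` (label `2`) differ. So (9.9.4) with `ℓ* ≥ 2` labels is consistent over ONE
field with ONE Vol-compatible absolute value once the roots are label-dependent ELEMENTS (numbers, no verdict). [folklore] -/
theorem padicLabelsScaling_abs_qrt_not_const (h2 : 2 ≤ lstar) :
    ¬ ∀ i j : Fin lstar, ((padicLabelsScaling p (by omega)).D i).abs ((padicLabelsScaling p (by omega)).qrt i) =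
      ((padicLabelsScaling p (by omega)).D j).abs ((padicLabelsScaling p (by omega)).qrt j) := by
  intro h
  have hp1 : (1 : ℝ) < p := by exact_mod_cast hp.out.one_lt
  have hp0 : (0 : ℝ) < p := by positivity
  have hlt : ((p : ℝ)⁻¹) ^ ((((⟨1, by omega⟩ : Fin lstar) : ℕ) + 1) ^ 2) <
      ((p : ℝ)⁻¹) ^ ((((⟨0, by omega⟩ : Fin lstar) : ℕ) + 1) ^ 2) :=
    pow_lt_pow_right_of_lt_one₀ (inv_pos.2 hp0) (inv_lt_one_of_one_lt₀ hp1) (by simp)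
  have h01 := h ⟨0, by omega⟩ ⟨1, by omega⟩
  rw [padicLabelsScaling_abs_qrt, padicLabelsScaling_abs_qrt] at h01
  exact hlt.ne' h01

/-- Consistency with p433446 (both directions visible): the rigidity lemma APPLIES to the model's datum and, its hypothesis being
false for `ℓ* ≥ 2`, yields nothing there; at `ℓ* = 1` its conclusion `ℓ* ≤ 1` is true anyway. [folklore] -/
theorem padicLabelsScaling_rigidity_inert (hl : 0 < lstar)
    (hc : ∀ i j : Fin lstar, ((padicLabelsScaling p hl).D i).abs ((padicLabelsScaling p hl).qrt i) =
      ((padicLabelsScaling p hl).D j).abs ((padicLabelsScaling p hl).qrt j)) : lstar ≤ 1 :=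
  (padicLabelsScaling p hl).lstar_le_one_of_rootScaling_of_abs_const (padicLabelsScaling_rootScaling p hl) hc

/-! ## 7. The one-place adelic assembly (Thm. 9.11.1 / Cor. 9.11.1.1 as printed, `𝕍^{odd,ss} = {w}`) -/

/-- The one-place adelic datum assembled from the model (E-t23's `adelicLocusDatum`, p432258). [folklore] -/
def padicLabelsAdelic (hl : 0 < lstar) : AdelicLocusDatum lstar (Fin 1) := adelicLocusDatum fun _ => padicLabelsScaling p hl

/-- **At the one-place adelic datum of the model, Thm. 9.11.1 and Cor. 9.11.1.1 (as typed by E-t4, p428048) HOLD — every `ℓ* ≥ 1`.**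
[claim: Joshi2024ATS3, status: disputed] -/
theorem padicLabelsAdelic_profile (hl : 0 < lstar) :
    (padicLabelsAdelic p hl).FundamentalEstimateVol ∧ (padicLabelsAdelic p hl).Cor91111 :=
  ⟨adelic_fundamentalEstimateVol_of_inputs (fun _ => padicLabelsScaling p hl) (fun _ => padicLabelsScaling_normLogBK p hl)
      fun _ => padicLabelsScaling_rootScaling p hl,
    adelic_cor91111_of_inputs (fun _ => padicLabelsScaling p hl) (fun _ => padicLabelsScaling_normLogBK p hl)
      (fun _ => padicLabelsScaling_rootScaling p hl) fun _ => padicLabelsScaling_logVolNonpos p hl⟩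

/-- **Both forms at once, every `ℓ* ≥ 2`, one field**: the volume chain's profile holds AND the rigidity hypothesis fails — the
located line of p433446 and the model are consistent («elements horn»). [folklore] -/
theorem padicLabelsScaling_profile_two_le (h2 : 2 ≤ lstar) :
    (padicLabelsScaling p (show 0 < lstar by omega)).toLocusDatum.FundamentalEstimateVol ∧
    (padicLabelsScaling p (show 0 < lstar by omega)).toLocusDatum.Cor91111 ∧
    ¬ ∀ i j : Fin lstar, ((padicLabelsScaling p (show 0 < lstar by omega)).D i).abs
        ((padicLabelsScaling p (show 0 < lstar by omega)).qrt i) =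
      ((padicLabelsScaling p (show 0 < lstar by omega)).D j).abs ((padicLabelsScaling p (show 0 < lstar by omega)).qrt j) :=
  ⟨padicLabelsScaling_fundamentalEstimateVol p _, padicLabelsScaling_cor91111 p _,
    padicLabelsScaling_abs_qrt_not_const p h2⟩

end Summit.ABC.IUTFork.Joshi.LogVol

end
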